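import Summits.NavierStokesRegularity.NavierStokesRegularity.Theorems.HodographBetchovFastClassSqueezeStreamStrainAlgebra
import Summits.NavierStokesRegularity.NavierStokesRegularity.Theorems.HodographBetchovFastClassSqueezeStreamStrainIBP
import Literature.Analysis.FluidPDE.LerayEnstrophyAPriori

/-!
# Crux `HodographBetchov.FastClassSqueeze` — velocity-truncated enstrophy: the dissipative slow term
# and the smooth-weight null Lagrangian

Helper file for the crux item stmt-NavierStokesRegularity-15832 (`FastClassSqueeze`, route
`HodographBetchov` of `NavierStokesRegularity`), part of the VELOCITY-TRUNCATED enstrophy ledger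
(`…StreamStrainSlice.lean`). After the cut-off integration by parts
`∫ χ(‖v‖²) P = −∫ χ(‖v‖²)⟪v, ∇ω ω⟫ − (shell term)` (`integral_cutoff_mul_production_eq`), the first
term carries the bounded factor `χ(‖v‖²)‖v‖ ≤ 2l` (`χ = 0` on `‖v‖ ≥ 2l`) and is paid by the
dissipation: `dissipative_term_le`,

  `−∫ χ(‖v‖²)⟪v, ∇ω ω⟫ ≤ (ν/4) ∫‖Δv‖² + 108 (‖curl‖² + 1) ‖curl‖² l² ν⁻¹ ∫|∇v|²_F`

(Young `2l ab ≤ εa² + l²ε⁻¹b²`, `∫‖∇ω‖² ≤ 27‖curl‖² ∫‖Δv‖²` by the Hessian–Laplacian inequality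
`lintegral_iteratedFDeriv_two_le_laplacian`, `‖ω‖ ≤ ‖curl‖ ‖∇v‖`). Also: the null-Lagrangian identity
with a smooth speed weight, `∫ f(‖V‖²) det ∇V = 0` (`integral_comp_normSq_mul_det_eq_zero`), used for
the Betchov fast term `∫ (1 − χ(‖v‖²)) (P − 4 det ∇v)`.

References: E. Miller, Arch. Ration. Mech. Anal. 235 (2020), proof of Thm. 5.2; L. C. Evans,
*Partial Differential Equations* (2010), §8.1.4.b; E. M. Stein, *Singular Integrals* (1970), III §1.3.
-/

noncomputable section

open MeasureTheory Set Function Filter Topology InnerProductSpace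
open scoped ENNReal NNReal ContDiff RealInnerProductSpace Laplacian

-- the summit and its single sub-problem share the name (CONVENTIONS §1), as in every Theorems file
set_option linter.dupNamespace false

namespace Summit.NavierStokesRegularity.NavierStokesRegularity.Theorems.FastClassSqueeze.StreamStrain

open Literature.Analysis Literature.Analysis.FluidPDE
open Summit.NavierStokesRegularity.NavierStokesRegularity.Theorems.ClassBudgetsRegularise

/-- Real-integral comparison from a lower-integral one: `∫ f ≤ C ∫ g` for nonnegative integrable
`f, g` with `∫⁻ f ≤ C ∫⁻ g`. [folklore] -/
theorem integral_le_const_mul_integral_of_lintegral {α : Type*} [MeasurableSpace α] {μ : Measure α}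
    {f g : α → ℝ} (hf : Integrable f μ) (hg : Integrable g μ) (hf0 : ∀ x, 0 ≤ f x) (hg0 : ∀ x, 0 ≤ g x)
    {C : ℝ} (hC : 0 ≤ C)
    (h : ∫⁻ x, ENNReal.ofReal (f x) ∂μ ≤ ENNReal.ofReal C * ∫⁻ x, ENNReal.ofReal (g x) ∂μ) :
    ∫ x, f x ∂μ ≤ C * ∫ x, g x ∂μ := by
  have h1 : ENNReal.ofReal (∫ x, f x ∂μ) ≤ ENNReal.ofReal (C * ∫ x, g x ∂μ) := by
    rw [ofReal_integral_eq_lintegral_ofReal hf (Filter.Eventually.of_forall hf0),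
      ENNReal.ofReal_mul hC, ofReal_integral_eq_lintegral_ofReal hg (Filter.Eventually.of_forall hg0)]
    exact h
  exact (ENNReal.ofReal_le_ofReal_iff (mul_nonneg hC (integral_nonneg hg0))).1 h1

/-- **Null-Lagrangian identity with a smooth speed weight**: `∫ f(‖V‖²) det ∇V = 0` for `V ∈ C²`
bounded with bounded gradient, `|∇V|² ∈ L¹`, and `f ∈ C^∞(ℝ)` (the core lemma
`integral_fderiv_comp_mul_det_eq_zero` with the line primitive of `y ↦ f(‖y‖²)`).
[cite: Evans2010, §8.1.4.b (determinants are null Lagrangians)] -/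
theorem integral_comp_normSq_mul_det_eq_zero {V : EuclideanSpace ℝ (Fin 3) → EuclideanSpace ℝ (Fin 3)}
    (hV : ContDiff ℝ 2 V) {B : ℝ} (hB : ∀ x, ‖V x‖ ≤ B) {K : ℝ} (hK : ∀ x, ‖fderiv ℝ V x‖ ≤ K)
    (hint : Integrable fun x => frobeniusNormSq (fderiv ℝ V x)) {f : ℝ → ℝ} (hf : ContDiff ℝ ∞ f) :
    ∫ x, f (‖V x‖ ^ 2) * (fderiv ℝ V x).det = 0 := by
  have hg : ContDiff ℝ ∞ fun y : EuclideanSpace ℝ (Fin 3) => f (‖y‖ ^ 2) := hf.comp (contDiff_id.norm_sq ℝ)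
  have h := integral_fderiv_comp_mul_det_eq_zero hV hB hK hint (contDiff_linePrimitive hg)
  simp_rw [fderiv_linePrimitive_apply hg] at h
  exact h

/-- **Null-Lagrangian identity with a smooth speed weight, registered helper-stub form** (the
`∀`-closed statement of `integral_comp_normSq_mul_det_eq_zero`).
[cite: Evans2010, §8.1.4.b (determinants are null Lagrangians)] -/
theorem speedWeight_nullLagrangian :
    ∀ (V : EuclideanSpace ℝ (Fin 3) → EuclideanSpace ℝ (Fin 3)), ContDiff ℝ 2 V →
      (∃ B : ℝ, ∀ x, ‖V x‖ ≤ B) → (∃ K : ℝ, ∀ x, ‖fderiv ℝ V x‖ ≤ K) →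
      MeasureTheory.Integrable (fun x => Literature.Analysis.FluidPDE.frobeniusNormSq (fderiv ℝ V x)) →
      ∀ (f : ℝ → ℝ), ContDiff ℝ (⊤ : ℕ∞) f → ∫ x, f (‖V x‖ ^ 2) * (fderiv ℝ V x).det = 0 := by
  intro V hV hB hK hint f hf
  obtain ⟨B, hB⟩ := hB
  obtain ⟨K, hK⟩ := hK
  exact integral_comp_normSq_mul_det_eq_zero hV hB hK hint hf

/-- **The shell term is integrable.** For `v ∈ C^∞` with bounded gradient and `Dv ∈ L²`, and a
cut-off with `χ'` continuous and `|χ'(s)| |s| ≤ D`, the shell density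
`⟪v, ω⟫ χ'(‖v‖²) 2⟪v, ∇v ω⟫` is integrable (`|·| ≤ 2 D ‖∇v‖ ‖ω‖² ≤ 2 D K ‖curl‖² |∇v|²_F`). [folklore] -/
theorem integrable_shell_term
    {v : EuclideanSpace ℝ (Fin 3) → EuclideanSpace ℝ (Fin 3)} (hv : ContDiff ℝ ∞ v)
    {K : ℝ} (hK : ∀ x, ‖fderiv ℝ v x‖ ≤ K) (hv1 : ∫⁻ x, ‖iteratedFDeriv ℝ 1 v x‖ₑ ^ 2 < ⊤)
    {χ : ℝ → ℝ} (hχ'c : Continuous (deriv χ)) {D : ℝ} (hχD : ∀ s, |deriv χ s| * |s| ≤ D) :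
    Integrable (fun x => ⟪v x, curl v x⟫ *
      (deriv χ (‖v x‖ ^ 2) * (2 * ⟪v x, fderiv ℝ v x (curl v x)⟫))) volume := by
  set cω : ℝ := ‖curlCLM‖ with hcω
  have hK0 : 0 ≤ K := (norm_nonneg _).trans (hK 0)
  have hv2' : ContDiff ℝ 2 v := hv.of_le (by norm_cast)
  have hv1' : ContDiff ℝ 1 v := hv.of_le (by norm_cast)
  have hω1 : ContDiff ℝ 1 (curl v) := contDiff_curl (n := 1) (by exact_mod_cast hv2')
  have cv : Continuous v := hv.continuous
  have cDv : Continuous (fderiv ℝ v) := hv1'.continuous_fderiv one_ne_zero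
  have ccurl : Continuous (curl v) := hω1.continuous
  have cχ' : Continuous fun y => deriv χ (‖v y‖ ^ 2) := hχ'c.comp (cv.norm.pow 2)
  have habs : ∀ x, |‖v x‖ ^ 2| = ‖v x‖ ^ 2 := fun x => abs_of_nonneg (sq_nonneg _)
  have hD0 : 0 ≤ D := by simpa using hχD 0
  have hDv_eq : ∀ x, ‖fderiv ℝ v x‖ = ‖iteratedFDeriv ℝ 1 v x‖ := fun x => by
    rw [← norm_iteratedFDeriv_fderiv, norm_iteratedFDeriv_zero]
  have l2Dv : ∫⁻ x, ‖fderiv ℝ v x‖ₑ ^ 2 < ⊤ :=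
    lintegral_enorm_sq_lt_top_of_norm_le (fun x => (hDv_eq x).le) hv1
  have hfrob_int : Integrable (fun x => frobeniusNormSq (fderiv ℝ v x)) volume := by
    have lfrob : ∫⁻ x, ENNReal.ofReal (FluidPDE.frobeniusNormSq (fderiv ℝ v x)) < ⊤ :=
      calc ∫⁻ x, ENNReal.ofReal (FluidPDE.frobeniusNormSq (fderiv ℝ v x))
          ≤ ∫⁻ x, 3 * ‖fderiv ℝ v x‖ₑ ^ 2 :=
            lintegral_mono fun x => ofReal_frobeniusNormSq_le_three_mul_enorm_sq _
        _ = 3 * ∫⁻ x, ‖fderiv ℝ v x‖ₑ ^ 2 := lintegral_const_mul' _ _ (by norm_num)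
        _ < ⊤ := ENNReal.mul_lt_top (by norm_num) l2Dv
    exact integrable_of_continuous_of_nonneg (FluidPDE.continuous_frobeniusNormSq_fderiv hv (by simp))
      (fun x => FluidPDE.frobeniusNormSq_nonneg _) lfrob
  have hω_le : ∀ x, ‖curl v x‖ ≤ cω * ‖fderiv ℝ v x‖ := fun x => norm_curl_le v x
  have hsq : ∀ x, ‖fderiv ℝ v x‖ ^ 2 ≤ frobeniusNormSq (fderiv ℝ v x) := fun x =>
    FluidPDE.sq_opNorm_le_frobeniusNormSq _
  have hω_sq : ∀ x, ‖curl v x‖ ^ 2 ≤ cω ^ 2 * frobeniusNormSq (fderiv ℝ v x) := fun x =>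
    calc ‖curl v x‖ ^ 2 ≤ (cω * ‖fderiv ℝ v x‖) ^ 2 := pow_le_pow_left₀ (norm_nonneg _) (hω_le x) 2
      _ = cω ^ 2 * ‖fderiv ℝ v x‖ ^ 2 := by ring
      _ ≤ cω ^ 2 * frobeniusNormSq (fderiv ℝ v x) := mul_le_mul_of_nonneg_left (hsq x) (sq_nonneg _)
  have cfrob : Continuous fun x => frobeniusNormSq (fderiv ℝ v x) :=
    FluidPDE.continuous_frobeniusNormSq_fderiv hv (by simp)
  set Rb : EuclideanSpace ℝ (Fin 3) → ℝ := fun x =>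
    ⟪v x, curl v x⟫ * (deriv χ (‖v x‖ ^ 2) * (2 * ⟪v x, fderiv ℝ v x (curl v x)⟫)) with hRb
  have cRb : Continuous Rb := (cv.inner ccurl).mul (cχ'.mul ((cv.inner (cDv.clm_apply ccurl)).const_mul 2))
  have hRb_abs : ∀ x, |Rb x| ≤ 2 * (|deriv χ (‖v x‖ ^ 2)| * ‖v x‖ ^ 2) * ‖fderiv ℝ v x‖ * ‖curl v x‖ ^ 2 := by
    intro x
    rw [hRb]; dsimp only
    rw [abs_mul, abs_mul, abs_mul, abs_two]
    calc |⟪v x, curl v x⟫| * (|deriv χ (‖v x‖ ^ 2)| * (2 * |⟪v x, fderiv ℝ v x (curl v x)⟫|))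
        ≤ (‖v x‖ * ‖curl v x‖) * (|deriv χ (‖v x‖ ^ 2)| * (2 * (‖v x‖ * (‖fderiv ℝ v x‖ * ‖curl v x‖)))) := by
          gcongr
          · exact abs_real_inner_le_norm _ _
          · exact (abs_real_inner_le_norm _ _).trans
              (mul_le_mul_of_nonneg_left ((fderiv ℝ v x).le_opNorm _) (norm_nonneg _))
      _ = 2 * (|deriv χ (‖v x‖ ^ 2)| * ‖v x‖ ^ 2) * ‖fderiv ℝ v x‖ * ‖curl v x‖ ^ 2 := by ring
  have hχs : ∀ x, |deriv χ (‖v x‖ ^ 2)| * ‖v x‖ ^ 2 ≤ D := fun x => by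
    have h := hχD (‖v x‖ ^ 2); rwa [habs] at h
  have iRb : Integrable Rb volume := by
    refine Integrable.mono' (hfrob_int.const_mul (2 * D * cω ^ 2 * K)) cRb.aestronglyMeasurable
      (Eventually.of_forall fun x => ?_)
    rw [Real.norm_eq_abs]
    refine (hRb_abs x).trans ?_
    calc 2 * (|deriv χ (‖v x‖ ^ 2)| * ‖v x‖ ^ 2) * ‖fderiv ℝ v x‖ * ‖curl v x‖ ^ 2
        ≤ 2 * D * K * (cω ^ 2 * frobeniusNormSq (fderiv ℝ v x)) := by
          gcongr
          · exact hχs x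
          · exact hK x
          · exact hω_sq x
      _ = 2 * D * cω ^ 2 * K * frobeniusNormSq (fderiv ℝ v x) := by ring
  exact iRb

/-- **The shell term is integrable, registered helper-stub form** (`∀`-closed). [folklore] -/
theorem shell_term_integrable :
    ∀ (v : EuclideanSpace ℝ (Fin 3) → EuclideanSpace ℝ (Fin 3)), ContDiff ℝ (⊤ : ℕ∞) v →
      (∃ K : ℝ, ∀ x, ‖fderiv ℝ v x‖ ≤ K) → (∫⁻ x, ‖iteratedFDeriv ℝ 1 v x‖ₑ ^ 2 < ⊤) →
      ∀ (χ : ℝ → ℝ), Continuous (deriv χ) → (∃ D : ℝ, ∀ s, |deriv χ s| * |s| ≤ D) →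
      MeasureTheory.Integrable (fun x => inner ℝ (v x) (Literature.Analysis.FluidPDE.curl v x) *
        (deriv χ (‖v x‖ ^ 2) * (2 * inner ℝ (v x)
          (fderiv ℝ v x (Literature.Analysis.FluidPDE.curl v x))))) := by
  intro v hv hK hv1 χ hχ hD
  obtain ⟨K, hK⟩ := hK
  obtain ⟨D, hD⟩ := hD
  exact integrable_shell_term hv hK hv1 hχ hD

/-- **The dissipative slow term is paid by the dissipation.** For `v ∈ C^∞(ℝ³; ℝ³)` with
`Dv, D²v, D³v ∈ L²`, `ω = curl v`, a level `l > 0` and a continuous cut-off `0 ≤ χ ≤ 1` with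
`χ(s) = 0` for `|s| ≥ 4l²` (so `χ(‖v‖²) ‖v‖ ≤ 2l`):
`−∫ χ(‖v‖²) ⟪v, ∇ω ω⟫ ≤ (ν/4) ∫ ‖Δv‖² + 108 (‖curl‖² + 1) ‖curl‖² l² ν⁻¹ ∫ |∇v|²_F`.
[cite: Miller2019, Thm 1.1 (proof of Thm 5.2)] -/
theorem dissipative_term_le {ν : ℝ} (hν : 0 < ν)
    {v : EuclideanSpace ℝ (Fin 3) → EuclideanSpace ℝ (Fin 3)} (hv : ContDiff ℝ ∞ v)
    (hv1 : ∫⁻ x, ‖iteratedFDeriv ℝ 1 v x‖ₑ ^ 2 < ⊤) (hv2 : ∫⁻ x, ‖iteratedFDeriv ℝ 2 v x‖ₑ ^ 2 < ⊤)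
    (hv3 : ∫⁻ x, ‖iteratedFDeriv ℝ 3 v x‖ₑ ^ 2 < ⊤)
    {l : ℝ} (hl : 0 < l) {χ : ℝ → ℝ} (hχc : Continuous χ) (hχ01 : ∀ s, 0 ≤ χ s ∧ χ s ≤ 1)
    (hχ0 : ∀ s, 4 * l ^ 2 ≤ |s| → χ s = 0) :
    -(∫ x, χ (‖v x‖ ^ 2) * ⟪v x, fderiv ℝ (curl v) x (curl v x)⟫) ≤
      ν / 4 * (∫ x, ‖(Δ v) x‖ ^ 2) +
        108 * (‖curlCLM‖ ^ 2 + 1) * ‖curlCLM‖ ^ 2 * l ^ 2 / ν * ∫ x, frobeniusNormSq (fderiv ℝ v x) := by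
  set cω : ℝ := ‖curlCLM‖ with hcω
  set Cl : ℝ := 108 * (cω ^ 2 + 1) * cω ^ 2 * l ^ 2 / ν with hCl
  have hcω0 : 0 ≤ cω := by rw [hcω]; exact norm_nonneg curlCLM
  have hv3' : ContDiff ℝ 3 v := hv.of_le (by norm_cast)
  have hv2' : ContDiff ℝ 2 v := hv.of_le (by norm_cast)
  have hv1' : ContDiff ℝ 1 v := hv.of_le (by norm_cast)
  have hω1 : ContDiff ℝ 1 (curl v) := contDiff_curl (n := 1) (by exact_mod_cast hv2')
  have cv : Continuous v := hv.continuous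
  have cDv : Continuous (fderiv ℝ v) := hv1'.continuous_fderiv one_ne_zero
  have ccurl : Continuous (curl v) := hω1.continuous
  have cDω : Continuous (fderiv ℝ (curl v)) := hω1.continuous_fderiv one_ne_zero
  -- the cut-off
  set φ : EuclideanSpace ℝ (Fin 3) → ℝ := fun x => χ (‖v x‖ ^ 2) with hφ
  have hφ01 : ∀ x, 0 ≤ φ x ∧ φ x ≤ 1 := fun x => hχ01 _
  have habs : ∀ x, |‖v x‖ ^ 2| = ‖v x‖ ^ 2 := fun x => abs_of_nonneg (sq_nonneg _)
  have hφv : ∀ x, φ x * ‖v x‖ ≤ 2 * l := by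
    intro x
    by_cases h2 : 2 * l ≤ ‖v x‖
    · have : φ x = 0 := by
        refine hχ0 _ ?_
        rw [habs]; nlinarith [h2, hl]
      rw [this, zero_mul]; positivity
    · rw [not_le] at h2
      calc φ x * ‖v x‖ ≤ 1 * ‖v x‖ := mul_le_mul_of_nonneg_right (hφ01 x).2 (norm_nonneg _)
        _ ≤ 2 * l := by rw [one_mul]; exact h2.le
  have hDv_eq : ∀ x, ‖fderiv ℝ v x‖ = ‖iteratedFDeriv ℝ 1 v x‖ := fun x => by
    rw [← norm_iteratedFDeriv_fderiv, norm_iteratedFDeriv_zero]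
  have l2Dv : ∫⁻ x, ‖fderiv ℝ v x‖ₑ ^ 2 < ⊤ :=
    lintegral_enorm_sq_lt_top_of_norm_le (fun x => (hDv_eq x).le) hv1
  have hfrob_int : Integrable (fun x => frobeniusNormSq (fderiv ℝ v x)) volume := by
    have lfrob : ∫⁻ x, ENNReal.ofReal (FluidPDE.frobeniusNormSq (fderiv ℝ v x)) < ⊤ :=
      calc ∫⁻ x, ENNReal.ofReal (FluidPDE.frobeniusNormSq (fderiv ℝ v x))
          ≤ ∫⁻ x, 3 * ‖fderiv ℝ v x‖ₑ ^ 2 :=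
            lintegral_mono fun x => ofReal_frobeniusNormSq_le_three_mul_enorm_sq _
        _ = 3 * ∫⁻ x, ‖fderiv ℝ v x‖ₑ ^ 2 := lintegral_const_mul' _ _ (by norm_num)
        _ < ⊤ := ENNReal.mul_lt_top (by norm_num) l2Dv
    exact integrable_of_continuous_of_nonneg (FluidPDE.continuous_frobeniusNormSq_fderiv hv (by simp))
      (fun x => FluidPDE.frobeniusNormSq_nonneg _) lfrob
  have hω_le : ∀ x, ‖curl v x‖ ≤ cω * ‖fderiv ℝ v x‖ := fun x => norm_curl_le v x
  have hsq : ∀ x, ‖fderiv ℝ v x‖ ^ 2 ≤ frobeniusNormSq (fderiv ℝ v x) := fun x =>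
    FluidPDE.sq_opNorm_le_frobeniusNormSq _
  have hω_sq : ∀ x, ‖curl v x‖ ^ 2 ≤ cω ^ 2 * frobeniusNormSq (fderiv ℝ v x) := fun x =>
    calc ‖curl v x‖ ^ 2 ≤ (cω * ‖fderiv ℝ v x‖) ^ 2 := pow_le_pow_left₀ (norm_nonneg _) (hω_le x) 2
      _ = cω ^ 2 * ‖fderiv ℝ v x‖ ^ 2 := by ring
      _ ≤ cω ^ 2 * frobeniusNormSq (fderiv ℝ v x) := mul_le_mul_of_nonneg_left (hsq x) (sq_nonneg _)
  have cφ : Continuous φ := hχc.comp (cv.norm.pow 2)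
  have hDω_le : ∀ x, ‖fderiv ℝ (curl v) x‖ ≤ cω * ‖iteratedFDeriv ℝ 2 v x‖ := by
    intro x
    have hcomp : fderiv ℝ (curl v) x = curlCLM.comp (fderiv ℝ (fderiv ℝ v) x) := by
      rw [curl_eq_curlCLM_comp]
      exact (curlCLM.hasFDerivAt.comp x
        (((hv2'.fderiv_right (m := 1) (by norm_num)).differentiable one_ne_zero) x).hasFDerivAt).fderiv
    rw [hcomp]
    refine (ContinuousLinearMap.opNorm_comp_le _ _).trans (le_of_eq ?_)
    rw [← norm_iteratedFDeriv_zero (𝕜 := ℝ) (f := fderiv ℝ (fderiv ℝ v)), norm_iteratedFDeriv_fderiv,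
      norm_iteratedFDeriv_fderiv]
  have hv2n : ∫⁻ x, ‖‖iteratedFDeriv ℝ 2 v x‖‖ₑ ^ 2 < ⊤ := by simpa only [enorm_norm] using hv2
  have l2Dω : ∫⁻ x, ‖fderiv ℝ (curl v) x‖ₑ ^ 2 < ⊤ := by
    have h : ∫⁻ x, ‖cω • ‖iteratedFDeriv ℝ 2 v x‖‖ₑ ^ 2 < ⊤ := lintegral_enorm_sq_const_smul_lt_top cω hv2n
    exact lintegral_enorm_sq_lt_top_of_norm_le (fun x => (hDω_le x).trans (le_abs_self _)) h
  have l2Dv' : ∫⁻ x, ‖‖fderiv ℝ v x‖‖ₑ ^ 2 < ⊤ := by simpa only [enorm_norm] using l2Dv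
  have l2ω : ∫⁻ x, ‖curl v x‖ₑ ^ 2 < ⊤ := by
    have h : ∫⁻ x, ‖cω • ‖fderiv ℝ v x‖‖ₑ ^ 2 < ⊤ := lintegral_enorm_sq_const_smul_lt_top cω l2Dv'
    exact lintegral_enorm_sq_lt_top_of_norm_le (fun x => (hω_le x).trans (le_abs_self _)) h
  have iDω2 : Integrable (fun x => ‖fderiv ℝ (curl v) x‖ ^ 2) volume :=
    FluidPDE.integrable_sq_norm_of_lintegral_lt_top cDω l2Dω
  have iω2 : Integrable (fun x => ‖curl v x‖ ^ 2) volume := FluidPDE.integrable_sq_norm_of_lintegral_lt_top ccurl l2ω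
  have cΔ : Continuous (Δ v) := (contDiff_one_laplacian_of_contDiff_three hv3').continuous
  have hΔ_le : ∀ x, ‖(Δ v) x‖ ≤ ‖(3 : ℝ) • iteratedFDeriv ℝ 2 v x‖ := fun x => by
    rw [norm_smul, Real.norm_of_nonneg (by norm_num : (0 : ℝ) ≤ 3)]
    exact norm_laplacian_le_three_mul_norm_iteratedFDeriv_two hv2' x
  have l2Δ : ∫⁻ x, ‖(Δ v) x‖ₑ ^ 2 < ⊤ :=
    lintegral_enorm_sq_lt_top_of_norm_le hΔ_le (lintegral_enorm_sq_const_smul_lt_top (3 : ℝ) hv2)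
  have iΔ2 : Integrable (fun x => ‖(Δ v) x‖ ^ 2) volume := FluidPDE.integrable_sq_norm_of_lintegral_lt_top cΔ l2Δ
  -- `∫ ‖∇ω‖² ≤ 27 ‖curl‖² ∫ ‖Δv‖²` (pointwise `‖∇ω‖ ≤ ‖curl‖ ‖D²v‖`, Hessian–Laplacian inequality)
  have hDω_int : ∫ x, ‖fderiv ℝ (curl v) x‖ ^ 2 ≤ 27 * cω ^ 2 * ∫ x, ‖(Δ v) x‖ ^ 2 := by
    have hpt : ∀ x, ENNReal.ofReal (‖fderiv ℝ (curl v) x‖ ^ 2) ≤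
        ENNReal.ofReal (cω ^ 2) * ‖iteratedFDeriv ℝ 2 v x‖ₑ ^ 2 := by
      intro x
      rw [← ofReal_norm, ← ENNReal.ofReal_pow (norm_nonneg _), ← ENNReal.ofReal_mul (sq_nonneg _)]
      refine ENNReal.ofReal_le_ofReal ?_
      calc ‖fderiv ℝ (curl v) x‖ ^ 2 ≤ (cω * ‖iteratedFDeriv ℝ 2 v x‖) ^ 2 :=
            pow_le_pow_left₀ (norm_nonneg _) (hDω_le x) 2
        _ = cω ^ 2 * ‖iteratedFDeriv ℝ 2 v x‖ ^ 2 := by ring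
    have hH := lintegral_iteratedFDeriv_two_le_laplacian hv hv1 hv2 hv3
    have eΔ : ∫⁻ x, ENNReal.ofReal (‖(Δ v) x‖ ^ 2) = ∫⁻ x, ‖(Δ v) x‖ₑ ^ 2 :=
      lintegral_congr fun x => by rw [ENNReal.ofReal_pow (norm_nonneg _), ofReal_norm]
    refine integral_le_const_mul_integral_of_lintegral iDω2 iΔ2 (fun x => sq_nonneg _)
      (fun x => sq_nonneg _) (by positivity)
      (le_trans (b := ENNReal.ofReal (cω ^ 2) * (27 * ∫⁻ x, ‖(Δ v) x‖ₑ ^ 2)) ?_ (le_of_eq ?_))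
    · exact (lintegral_mono hpt).trans
        ((lintegral_const_mul' (ENNReal.ofReal (cω ^ 2)) (fun x => ‖iteratedFDeriv ℝ 2 v x‖ₑ ^ 2)
          ENNReal.ofReal_ne_top).le.trans (mul_le_mul_right hH _))
    · -- `ofReal (cω²) (27 ∫⁻ ‖Δv‖ₑ²) = ofReal (27 cω²) ∫⁻ ofReal ‖Δv‖²`
      rw [eΔ, ← mul_assoc, mul_comm (ENNReal.ofReal (cω ^ 2)) 27,
        ENNReal.ofReal_mul (by norm_num : (0 : ℝ) ≤ 27)]
      norm_num
  have hω_int : ∫ x, ‖curl v x‖ ^ 2 ≤ cω ^ 2 * ∫ x, frobeniusNormSq (fderiv ℝ v x) := by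
    rw [← integral_const_mul]
    exact integral_mono iω2 (hfrob_int.const_mul _) fun x => hω_sq x
  -- Young: `|Q| ≤ ε ‖∇ω‖² + (l²/ε) ‖ω‖²`, `ε = ν / (108 (‖curl‖² + 1))`
  set ε : ℝ := ν / (108 * (cω ^ 2 + 1)) with hε
  have hε0 : 0 < ε := by positivity
  have cQ : Continuous fun x => φ x * ⟪v x, fderiv ℝ (curl v) x (curl v x)⟫ :=
    cφ.mul (cv.inner (cDω.clm_apply ccurl))
  have hQ_pt : ∀ x, |φ x * ⟪v x, fderiv ℝ (curl v) x (curl v x)⟫| ≤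
      ε * ‖fderiv ℝ (curl v) x‖ ^ 2 + l ^ 2 / ε * ‖curl v x‖ ^ 2 := by
    intro x
    have h1 : |φ x * ⟪v x, fderiv ℝ (curl v) x (curl v x)⟫| ≤
        2 * l * (‖fderiv ℝ (curl v) x‖ * ‖curl v x‖) := by
      rw [abs_mul, abs_of_nonneg (hφ01 x).1]
      calc φ x * |⟪v x, fderiv ℝ (curl v) x (curl v x)⟫|
          ≤ φ x * (‖v x‖ * (‖fderiv ℝ (curl v) x‖ * ‖curl v x‖)) := by
            refine mul_le_mul_of_nonneg_left ((abs_real_inner_le_norm _ _).trans ?_) (hφ01 x).1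
            exact mul_le_mul_of_nonneg_left ((fderiv ℝ (curl v) x).le_opNorm _) (norm_nonneg _)
        _ = (φ x * ‖v x‖) * (‖fderiv ℝ (curl v) x‖ * ‖curl v x‖) := by ring
        _ ≤ 2 * l * (‖fderiv ℝ (curl v) x‖ * ‖curl v x‖) :=
            mul_le_mul_of_nonneg_right (hφv x) (by positivity)
    refine h1.trans ?_
    -- `2 l a b ≤ ε a² + (l²/ε) b²`
    have key : 0 ≤ ε * (‖fderiv ℝ (curl v) x‖ - l / ε * ‖curl v x‖) ^ 2 := by positivity
    have hεε : ε * (l / ε) = l := mul_div_cancel₀ l hε0.ne'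
    have hεε2 : ε * (l / ε) ^ 2 = l ^ 2 / ε := by
      rw [div_pow, ← mul_div_assoc, pow_two ε, mul_div_mul_left _ _ hε0.ne']
    have key' : ε * (‖fderiv ℝ (curl v) x‖ - l / ε * ‖curl v x‖) ^ 2 =
        ε * ‖fderiv ℝ (curl v) x‖ ^ 2 - 2 * (ε * (l / ε)) * (‖fderiv ℝ (curl v) x‖ * ‖curl v x‖) +
          ε * (l / ε) ^ 2 * ‖curl v x‖ ^ 2 := by ring
    rw [hεε, hεε2] at key'
    linarith [key, key']
  have iQ : Integrable (fun x => φ x * ⟪v x, fderiv ℝ (curl v) x (curl v x)⟫) volume := by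
    refine Integrable.mono' ((iDω2.const_mul ε).add (iω2.const_mul (l ^ 2 / ε))) cQ.aestronglyMeasurable
      (Eventually.of_forall fun x => ?_)
    rw [Real.norm_eq_abs]
    exact hQ_pt x
  have hQ : -(∫ x, φ x * ⟪v x, fderiv ℝ (curl v) x (curl v x)⟫) ≤
      ν / 4 * (∫ x, ‖(Δ v) x‖ ^ 2) + Cl * ∫ x, frobeniusNormSq (fderiv ℝ v x) := by
    have h1 : -(∫ x, φ x * ⟪v x, fderiv ℝ (curl v) x (curl v x)⟫) ≤
        ∫ x, (ε * ‖fderiv ℝ (curl v) x‖ ^ 2 + l ^ 2 / ε * ‖curl v x‖ ^ 2) := by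
      rw [← integral_neg]
      refine integral_mono iQ.neg ((iDω2.const_mul ε).add (iω2.const_mul (l ^ 2 / ε))) fun x => ?_
      exact (neg_le_abs _).trans (hQ_pt x)
    rw [integral_add (iDω2.const_mul ε) (iω2.const_mul (l ^ 2 / ε)), integral_const_mul,
      integral_const_mul] at h1
    have hΔ0 : 0 ≤ ∫ x, ‖(Δ v) x‖ ^ 2 := integral_nonneg fun x => sq_nonneg _
    have hfrob0 : 0 ≤ ∫ x, frobeniusNormSq (fderiv ℝ v x) :=
      integral_nonneg fun x => FluidPDE.frobeniusNormSq_nonneg _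
    have hMne : (108 : ℝ) * (cω ^ 2 + 1) ≠ 0 := by positivity
    have hε' : ε * (108 * (cω ^ 2 + 1)) = ν := by rw [hε]; exact div_mul_cancel₀ ν hMne
    have hε'' : ε * (cω ^ 2 + 1) * 108 = ν := by rw [← hε']; ring
    have h27 : 27 * ε * cω ^ 2 ≤ ν / 4 := by
      calc 27 * ε * cω ^ 2 = 27 * (ε * cω ^ 2) := by ring
        _ ≤ 27 * (ε * (cω ^ 2 + 1)) := by gcongr; linarith
        _ = ν / 4 := by linarith [hε'']
    have h2 : ε * ∫ x, ‖fderiv ℝ (curl v) x‖ ^ 2 ≤ ν / 4 * ∫ x, ‖(Δ v) x‖ ^ 2 := by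
      have hA : ε * ∫ x, ‖fderiv ℝ (curl v) x‖ ^ 2 ≤ ε * (27 * cω ^ 2 * ∫ x, ‖(Δ v) x‖ ^ 2) :=
        mul_le_mul_of_nonneg_left hDω_int hε0.le
      have hB : ε * (27 * cω ^ 2 * ∫ x, ‖(Δ v) x‖ ^ 2) = (27 * ε * cω ^ 2) * ∫ x, ‖(Δ v) x‖ ^ 2 := by
        ring
      have hC : (27 * ε * cω ^ 2) * ∫ x, ‖(Δ v) x‖ ^ 2 ≤ ν / 4 * ∫ x, ‖(Δ v) x‖ ^ 2 :=
        mul_le_mul_of_nonneg_right h27 hΔ0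
      linarith [hA, hB, hC]
    have hlε : l ^ 2 / ε = l ^ 2 * (108 * (cω ^ 2 + 1)) / ν := by rw [hε, div_div_eq_mul_div]
    have h3 : l ^ 2 / ε * ∫ x, ‖curl v x‖ ^ 2 ≤ Cl * ∫ x, frobeniusNormSq (fderiv ℝ v x) := by
      have hA : l ^ 2 / ε * ∫ x, ‖curl v x‖ ^ 2 ≤ l ^ 2 / ε * (cω ^ 2 * ∫ x, frobeniusNormSq (fderiv ℝ v x)) :=
        mul_le_mul_of_nonneg_left hω_int (by positivity)
      have hB : l ^ 2 / ε * (cω ^ 2 * ∫ x, frobeniusNormSq (fderiv ℝ v x)) =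
          Cl * ∫ x, frobeniusNormSq (fderiv ℝ v x) := by
        rw [hlε, hCl]; ring
      linarith [hA, hB]
    linarith
  exact hQ

end Summit.NavierStokesRegularity.NavierStokesRegularity.Theorems.FastClassSqueeze.StreamStrain

end
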